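import Mathlib

/-!
# The abstract Marica–Schönheim theorem over `𝔽₂` — a five-line parity proof

Helper file for crux `stmt-CriticalPhenomena-4575` (`NoHeavyLowerTail`, route `PercNearOneGluingNoHeavy`), new-inequality factory
seat `prim-ineq-gen-3` (gen 28).  Everything here is PROVED; no definitions.

CONJECTURE (C0)-LOC (memo `run/shared/lean/prim/prim-ineq-gen-3/CONJECTURE-LOC.md`) replaces a family of sets by an ABSTRACT STRUCTURE
on the index set: a containment relation `S i k` ("`A_i ⊆ A_k`") and a covering relation `σ i j k` ("`A_i ⊆ A_j ∪ A_k`", symmetric in `j, k`),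
subject to Horn axioms; the abstract containment matrix has rows `j` and columns the pairs `(i, k)` with `¬ S i k` ("`E = A_i \\ A_k ≠ ∅`"),
with entries `[E ⊆ A_j]` read as: `1` for `j = i`, `0` for `j = k`, `σ i j k` otherwise.  The Marica–Schönheim rank theorem (the rows of the
containment matrix on `𝒜 \\ 𝒜` are independent; tree: `linearIndependent_incidence_diffs_field`, Mathlib: `Finset.card_le_card_diffs`)
is proved for families by Möbius inversion over the difference poset — a structure the abstract setting does not have.  Over `𝔽₂` there
is a parity argument which needs almost nothing:

* `abstract_marica_schoenheim_parity` — ★ let `S` be irreflexive and transitive, `σ i j k` symmetric in `(j,k)` with `S i k → σ i j k`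
  (axiom `Sσ`).  If a set `x` of indices of even size satisfies the column parities `1 + #{j ∈ x \\ {i,k} : σ i j k} ≡ 0 (mod 2)` for all
  `i ≠ k` in `x` with `¬ S i k`, then `x = ∅`.  [Fix `i ∈ x` with the most `S`-predecessors.  Summing the (unguarded) column parities over
  `k ∈ x \\ {i}`, the `σ`-terms cancel in pairs by symmetry, leaving `#{k ∈ x : S i k} ≡ |x| − 1 ≡ 1`: so `S i k` for some `k ∈ x`, and `k` has
  more predecessors than `i`.]  Consequently the abstract containment matrix of every axiom-`(St, Sσ)` structure has full row rank over `𝔽₂`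
  (hence over `ℚ`): the `t = 0` end of the abstract pencil is injective — confirmed independently by SAT for `m ≤ 9` (kit j243196).
* `eq_empty_of_even_containment_counts` — the same argument for an honest family: if `x ⊆ 𝒜` and every difference `E ∈ 𝒜 \\ 𝒜` lies in an
  EVEN number of members of `x`, then `x = ∅` (a parity proof of Marica–Schönheim: the rows of the containment matrix on `𝒜 \\ 𝒜` are
  independent over `𝔽₂`, so `|𝒜 \\ 𝒜| ≥ |𝒜|`).
(prim-ineq-gen-3 gen 28, 2026-08-25.)
-/

namespace Summit.CriticalPhenomena.PercolationContinuityZ3.Theorems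

namespace OrderedDifferences

open Finset
open scoped FinsetFamily

/-- **Abstract Marica–Schönheim over `𝔽₂`.**  See the module doc-string. -/
theorem abstract_marica_schoenheim_parity {ι : Type*} [DecidableEq ι]
    (S : ι → ι → Prop) [DecidableRel S] (σ : ι → ι → ι → Prop) [∀ i j k, Decidable (σ i j k)]
    (hirr : ∀ i, ¬ S i i) (htrans : ∀ i j k, S i j → S j k → S i k)
    (hsymm : ∀ i j k, σ i j k → σ i k j) (hSσ : ∀ i j k, S i k → σ i j k)
    (x : Finset ι) (heven : Even x.card)
    (hcol : ∀ i ∈ x, ∀ k ∈ x, i ≠ k → ¬ S i k →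
      Even (1 + (((x.erase i).erase k).filter (fun j => σ i j k)).card)) :
    x = ∅ := by
  classical
  by_contra hne
  -- a member of `x` with the most `S`-predecessors
  obtain ⟨i, hi, hmax⟩ := exists_max_image x (fun i => (x.filter (fun l => S l i)).card)
    (nonempty_iff_ne_empty.mpr hne)
  -- it suffices to find `k ∈ x` with `S i k`
  suffices key : ∃ k ∈ x, S i k by
    obtain ⟨k, hk, hik⟩ := key
    have hlt : (x.filter (fun l => S l i)).card < (x.filter (fun l => S l k)).card := by
      apply card_lt_card
      rw [ssubset_iff_of_subset]
      · exact ⟨i, by simp [hi, hik], by simp [hirr i]⟩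
      · intro l hl
        simp only [mem_filter] at hl ⊢
        exact ⟨hl.1, htrans l i k hl.2 hik⟩
    exact absurd (hmax k hk) (not_le.mpr hlt)
  -- parity computation in `ZMod 2`
  set x' : Finset ι := x.erase i with hx'
  let h : ι → ι → ZMod 2 := fun j k => if j ≠ k ∧ σ i j k then 1 else 0
  let e : ι → ZMod 2 := fun k => 1 + (if S i k then 1 else 0) + ∑ j ∈ x', h j k
  have hx'card : x'.card = x.card - 1 := by rw [hx']; exact card_erase_of_mem hi
  have hxpos : 0 < x.card := card_pos.mpr ⟨i, hi⟩
  -- each unguarded column parity vanishes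
  have he : ∀ k ∈ x', e k = 0 := by
    intro k hk
    have hkx : k ∈ x := mem_of_mem_erase hk
    have hki : k ≠ i := ne_of_mem_erase hk
    have hsum : ∑ j ∈ x', h j k = (((x'.erase k).filter (fun j => σ i j k)).card : ZMod 2) := by
      have e1 : ∑ j ∈ x', h j k = ∑ j ∈ x', (if (j ≠ k ∧ σ i j k) then (1 : ZMod 2) else 0) := rfl
      rw [e1, sum_boole]
      congr 2
      ext j
      simp only [mem_filter, mem_erase, ne_eq]
      tauto
    by_cases hS : S i k
    · -- all σ i j k hold: the sum is |x| - 2, and 1 + 1 + (|x| - 2) = |x| ≡ 0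
      have hall : ((x'.erase k).filter (fun j => σ i j k)) = x'.erase k := by
        apply filter_true_of_mem
        intro j _
        exact hSσ i j k hS
      have hc : (x'.erase k).card = x.card - 2 := by
        rw [card_erase_of_mem hk, hx'card]; omega
      simp only [e, hS, if_true]
      rw [hsum, hall, hc]
      obtain ⟨a, ha⟩ := heven
      have h2 : x.card - 2 + 2 = x.card := by
        have : 2 ≤ x.card := by
          have h1 : 1 < x.card := by
            rw [← hx'card.symm.trans (card_erase_of_mem hi)] at *
            have : 0 < x'.card := card_pos.mpr ⟨k, hk⟩
            omega
          omega
        omega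
      have hcast : ((x.card - 2 : ℕ) : ZMod 2) = ((x.card : ℕ) : ZMod 2) - 2 := by
        rw [← h2]; push_cast; ring_nf
      rw [hcast]
      have hx0 : ((x.card : ℕ) : ZMod 2) = 0 := (ZMod.natCast_eq_zero_iff_even).mpr ⟨a, ha⟩
      rw [hx0]
      decide
    · -- a genuine column: the hypothesis
      have hc := hcol i hi k hkx (Ne.symm hki) hS
      simp only [e, hS, if_false, add_zero]
      rw [hsum]
      have : ((1 + (((x.erase i).erase k).filter (fun j => σ i j k)).card : ℕ) : ZMod 2) = 0 :=
        (ZMod.natCast_eq_zero_iff_even).mpr hc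
      push_cast at this
      rw [hx']
      exact this
  -- sum of the column parities over k ∈ x'
  have htot : ∑ k ∈ x', e k = 0 := sum_eq_zero he
  -- the σ-part cancels in pairs
  have hpairs : ∑ k ∈ x', ∑ j ∈ x', h j k = 0 := by
    rw [← sum_product' (s := x') (t := x') (f := fun k j => h j k)]
    refine sum_involution (fun p _ => p.swap) ?_ ?_ ?_ ?_
    · intro p hp
      rcases p with ⟨k, j⟩
      simp only [Prod.swap_prod_mk, h]
      by_cases hjk : j ≠ k ∧ σ i j k
      · have hkj : k ≠ j ∧ σ i k j := ⟨fun e' => hjk.1 e'.symm, hsymm i j k hjk.2⟩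
        rw [if_pos hjk, if_pos hkj]; decide
      · have hkj : ¬ (k ≠ j ∧ σ i k j) := fun h' => hjk ⟨fun e' => h'.1 e'.symm, hsymm i k j h'.2⟩
        rw [if_neg hjk, if_neg hkj]; decide
    · intro p hp hne'
      rcases p with ⟨k, j⟩
      simp only [h] at hne'
      intro heq
      simp only [Prod.swap_prod_mk, Prod.mk.injEq] at heq
      apply hne'
      rw [if_neg (fun h' => h'.1 heq.1)]
    · intro p hp
      simp only [mem_product] at hp ⊢
      exact ⟨hp.2, hp.1⟩
    · intro p hp
      simp
  -- the S-part and the constant part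
  have hsplit : ∑ k ∈ x', e k = (x'.card : ZMod 2) + ∑ k ∈ x', (if S i k then (1 : ZMod 2) else 0) + ∑ k ∈ x', ∑ j ∈ x', h j k := by
    simp only [e, sum_add_distrib, sum_const, nsmul_eq_mul, mul_one]
  rw [htot, hpairs, add_zero, sum_boole] at hsplit
  -- x'.card is odd
  have hodd : (x'.card : ZMod 2) = 1 := by
    rw [ZMod.natCast_eq_one_iff_odd, hx'card]
    obtain ⟨a, ha⟩ := heven
    exact ⟨a - 1, by omega⟩
  rw [hodd] at hsplit
  -- hence the number of S-successors of i in x' is odd, in particular non-zero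
  have hne0 : (x'.filter (fun k => S i k)).card ≠ 0 := by
    intro h0
    rw [h0] at hsplit
    exact absurd hsplit.symm (by decide)
  obtain ⟨k, hk⟩ := card_pos.mp (Nat.pos_of_ne_zero hne0)
  rw [mem_filter] at hk
  exact ⟨k, mem_of_mem_erase hk.1, hk.2⟩

/-- **A parity proof of Marica–Schönheim.**  If `x ⊆ 𝒜` and every difference `E ∈ 𝒜 \\ 𝒜` is contained in an even number of members of
`x`, then `x = ∅`.  Equivalently the rows of the containment matrix `[E ⊆ A]` (`A ∈ 𝒜`, `E ∈ 𝒜 \\ 𝒜`) are independent over `𝔽₂`, so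
`|𝒜 \\ 𝒜| ≥ |𝒜|`.  [Every member of `x` would be strictly contained in an odd number of members of `x`.] -/
theorem eq_empty_of_even_containment_counts {α : Type*} [DecidableEq α] (𝒜 x : Finset (Finset α)) (hx : x ⊆ 𝒜)
    (h : ∀ E ∈ 𝒜 \\ 𝒜, Even ((x.filter (fun A => E ⊆ A)).card)) : x = ∅ := by
  classical
  refine abstract_marica_schoenheim_parity (ι := Finset α) (fun A B => A ⊂ B) (fun A C B => A ⊆ C ∪ B)
    (fun A => ssubset_irrefl A) (fun A B C hAB hBC => hAB.trans hBC)
    (fun A C B hs => by rwa [union_comm]) (fun A C B hs => hs.subset.trans subset_union_right) x ?_ ?_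
  · -- |x| even: the column E = ∅
    by_cases hx0 : x = ∅
    · subst hx0; simp
    · obtain ⟨A0, hA0⟩ := nonempty_iff_ne_empty.mpr hx0
      have h0 := h ∅ (Finset.mem_diffs.mpr ⟨A0, hx hA0, A0, hx hA0, by simp⟩)
      rwa [filter_true_of_mem (fun A _ => empty_subset A)] at h0
  · -- the column E = A \ B
    intro A hA B hB hAB hnot
    have hc := h _ (Finset.mem_diffs.mpr ⟨A, hx hA, B, hx hB, rfl⟩)
    have hAB' : ¬ A ⊆ B := fun hsub => hsub.eq_or_ssubset.elim hAB hnot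
    have key : ∀ C : Finset α, A \ B ⊆ C ↔ A ⊆ C ∪ B := fun C => by
      rw [union_comm]; exact sdiff_le_iff
    have hset : x.filter (fun C => A \ B ⊆ C) = insert A (((x.erase A).erase B).filter (fun C => A ⊆ C ∪ B)) := by
      ext C
      simp only [mem_filter, mem_insert, mem_erase, key]
      constructor
      · rintro ⟨hC, hcov⟩
        by_cases hCA : C = A
        · exact Or.inl hCA
        · refine Or.inr ⟨⟨?_, hCA, hC⟩, hcov⟩
          rintro rfl
          exact hAB' (by simpa using hcov)
      · rintro (rfl | ⟨⟨hCB, hCA, hC⟩, hcov⟩)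
        · exact ⟨hA, subset_union_left⟩
        · exact ⟨hC, hcov⟩
    rw [hset, card_insert_of_notMem (by simp)] at hc
    rwa [add_comm] at hc

/-- **Abstract Marica–Schönheim over `ℤ` (hence over every field of characteristic `0`).**  Under the hypotheses of
`abstract_marica_schoenheim_parity`, an INTEGER vector `a` supported on a finite set `s` of indices which is annihilated by the `∅`
column (`∑ a_j = 0`) and by every abstract difference column inside `s` (`a_i + ∑_{j ∈ s \ {i,k}, σ i j k} a_j = 0` for `i ≠ k` in `s` with
`¬ S i k`) vanishes.  [Divide `a` by `2` until some coordinate is odd; the set of odd coordinates then satisfies the parity hypotheses.]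
So the abstract containment matrix of an axiom-`(St, Sσ)` structure has full row rank over `ℚ`: the `t = 0` end of the abstract pencil of
CONJECTURE (C0)-LOC is injective. -/
theorem abstract_marica_schoenheim_int {ι : Type*} [DecidableEq ι]
    (S : ι → ι → Prop) [DecidableRel S] (σ : ι → ι → ι → Prop) [∀ i j k, Decidable (σ i j k)]
    (hirr : ∀ i, ¬ S i i) (htrans : ∀ i j k, S i j → S j k → S i k)
    (hsymm : ∀ i j k, σ i j k → σ i k j) (hSσ : ∀ i j k, S i k → σ i j k)
    (s : Finset ι) (a : ι → ℤ) (hempty : ∑ j ∈ s, a j = 0)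
    (hcol : ∀ i ∈ s, ∀ k ∈ s, i ≠ k → ¬ S i k →
      a i + ∑ j ∈ ((s.erase i).erase k).filter (fun j => σ i j k), a j = 0) :
    ∀ j ∈ s, a j = 0 := by
  classical
  -- descent on ∑ |a_j|
  suffices H : ∀ (n : ℕ) (a : ι → ℤ), ∑ j ∈ s, (a j).natAbs ≤ n → (∑ j ∈ s, a j = 0) →
      (∀ i ∈ s, ∀ k ∈ s, i ≠ k → ¬ S i k → a i + ∑ j ∈ ((s.erase i).erase k).filter (fun j => σ i j k), a j = 0) →
      ∀ j ∈ s, a j = 0 from H _ a le_rfl hempty hcol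
  intro n
  induction n with
  | zero =>
    intro a hle _ _ j hj
    have : (a j).natAbs ≤ 0 := le_trans (single_le_sum (f := fun j => (a j).natAbs) (fun _ _ => Nat.zero_le _) hj) hle
    exact Int.natAbs_eq_zero.mp (Nat.le_zero.mp this)
  | succ n ih =>
    intro a hle hempty hcol
    -- the set of odd coordinates
    set x : Finset ι := s.filter (fun j => Odd (a j)) with hx
    by_cases hx0 : x = ∅
    · -- all coordinates even: halve
      have hev : ∀ j ∈ s, Even (a j) := by
        intro j hj
        by_contra hodd
        have : j ∈ x := by rw [hx, mem_filter]; exact ⟨hj, Int.not_even_iff_odd.mp hodd⟩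
        rw [hx0] at this; exact absurd this (by simp)
      by_cases hall : ∀ j ∈ s, a j = 0
      · exact hall
      push Not at hall
      obtain ⟨j0, hj0, hj0ne⟩ := hall
      let a' : ι → ℤ := fun j => a j / 2
      have ha' : ∀ j ∈ s, a j = 2 * a' j := fun j hj => (Int.mul_ediv_cancel' (even_iff_two_dvd.mp (hev j hj))).symm
      have hle' : ∑ j ∈ s, (a' j).natAbs ≤ n := by
        have hlt : ∑ j ∈ s, (a' j).natAbs < ∑ j ∈ s, (a j).natAbs := by
          apply sum_lt_sum
          · intro j hj; rw [ha' j hj, Int.natAbs_mul]; simp; omega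
          · refine ⟨j0, hj0, ?_⟩
            rw [ha' j0 hj0, Int.natAbs_mul]
            have : (a' j0).natAbs ≠ 0 := by
              intro h0; apply hj0ne; rw [ha' j0 hj0, Int.natAbs_eq_zero.mp h0]; ring
            simp; omega
        omega
      have hempty' : ∑ j ∈ s, a' j = 0 := by
        have : ∑ j ∈ s, a j = 2 * ∑ j ∈ s, a' j := by
          rw [mul_sum]; exact sum_congr rfl fun j hj => ha' j hj
        rw [this] at hempty
        exact (mul_eq_zero.mp hempty).resolve_left (by norm_num)
      have hcol' : ∀ i ∈ s, ∀ k ∈ s, i ≠ k → ¬ S i k →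
          a' i + ∑ j ∈ ((s.erase i).erase k).filter (fun j => σ i j k), a' j = 0 := by
        intro i hi k hk hik hS
        have h := hcol i hi k hk hik hS
        have e : a i + ∑ j ∈ ((s.erase i).erase k).filter (fun j => σ i j k), a j =
            2 * (a' i + ∑ j ∈ ((s.erase i).erase k).filter (fun j => σ i j k), a' j) := by
          rw [mul_add, mul_sum, ha' i hi]
          congr 1
          exact sum_congr rfl fun j hj => ha' j (mem_of_mem_erase (mem_of_mem_erase (mem_filter.mp hj).1))
        rw [e] at h
        exact (mul_eq_zero.mp h).resolve_left (by norm_num)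
      intro j hj
      have := ih a' hle' hempty' hcol' j hj
      rw [ha' j hj, this]; ring
    · -- the odd coordinates satisfy the parity hypotheses: contradiction
      exfalso
      have hxs : x ⊆ s := filter_subset _ _
      -- casting to ZMod 2: a_j ↦ [j ∈ x]
      have hcast : ∀ j ∈ s, ((a j : ℤ) : ZMod 2) = if j ∈ x then 1 else 0 := by
        intro j hj
        by_cases hjx : j ∈ x
        · rw [if_pos hjx]
          exact ZMod.intCast_eq_one_iff_odd.mpr (by rw [hx, mem_filter] at hjx; exact hjx.2)
        · rw [if_neg hjx]
          have : Even (a j) := by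
            rcases Int.even_or_odd (a j) with h | h
            · exact h
            · exact absurd (show j ∈ x by rw [hx, mem_filter]; exact ⟨hj, h⟩) hjx
          exact ZMod.intCast_eq_zero_iff_even.mpr this
      have heven : Even x.card := by
        have h := congrArg (fun z : ℤ => (z : ZMod 2)) hempty
        simp only [Int.cast_sum, Int.cast_zero] at h
        rw [sum_congr rfl hcast, sum_boole] at h
        have hc : (s.filter (fun j => j ∈ x)) = x := by
          ext j; simp only [mem_filter]; exact ⟨fun h => h.2, fun h => ⟨hxs h, h⟩⟩
        rw [hc] at h
        exact ZMod.natCast_eq_zero_iff_even.mp h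
      have hcolx : ∀ i ∈ x, ∀ k ∈ x, i ≠ k → ¬ S i k →
          Even (1 + (((x.erase i).erase k).filter (fun j => σ i j k)).card) := by
        intro i hi k hk hik hS
        have h := congrArg (fun z : ℤ => (z : ZMod 2)) (hcol i (hxs hi) k (hxs hk) hik hS)
        simp only [Int.cast_add, Int.cast_sum, Int.cast_zero] at h
        rw [hcast i (hxs hi), if_pos hi] at h
        have hsum : ∑ j ∈ ((s.erase i).erase k).filter (fun j => σ i j k), ((a j : ℤ) : ZMod 2) =
            ((((x.erase i).erase k).filter (fun j => σ i j k)).card : ZMod 2) := by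
          rw [sum_congr rfl (fun j hj => hcast j (mem_of_mem_erase (mem_of_mem_erase (mem_filter.mp hj).1))), sum_boole]
          congr 2
          ext j
          simp only [mem_filter, mem_erase]
          constructor
          · rintro ⟨⟨⟨hjk, hji, hjs⟩, hσ⟩, hjx⟩
            exact ⟨⟨hjk, hji, hjx⟩, hσ⟩
          · rintro ⟨⟨hjk, hji, hjx⟩, hσ⟩
            exact ⟨⟨⟨hjk, hji, hxs hjx⟩, hσ⟩, hjx⟩
        rw [hsum] at h
        have : ((1 + (((x.erase i).erase k).filter (fun j => σ i j k)).card : ℕ) : ZMod 2) = 0 := by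
          push_cast; exact h
        exact ZMod.natCast_eq_zero_iff_even.mp this
      exact hx0 (abstract_marica_schoenheim_parity S σ hirr htrans hsymm hSσ x heven hcolx)

end OrderedDifferences

end Summit.CriticalPhenomena.PercolationContinuityZ3.Theorems
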